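import Summits.ResolutionOfSingularities.ResolutionOfSingularities.Theorems.EquisingularLiftEquisingularLiftOfSigmaMaxCP2008
import Summits.ResolutionOfSingularities.ResolutionOfSingularities.Theorems.TeissierJungTeissierReductionLowDim
import Literature.AlgebraicGeometry.Resolution.NuEliminationInDim
import HarnessLib

/-!
# Crux `EquisingularLift` (stmt-ResolutionOfSingularities-15660), line `Sketch` (skeleton v10c `f3e6993bf39ec5c9`):
# the WHOLE crux — and its open residual `stub_blowupModel_ge_five` — from ONE uniform programme statement,
# «`Σ^max`-eliminations exist in dimension `≤ d`» (Cossart–Jannsen–Saito, Cor. 6.18's hypothesis, `SigmaMaxEliminationInDim d`)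

[OURS · leafhand-res-equisingularlift-1 g1, 2026-08-31] AI-produced, weaker than expert review; NOT a statement of any
manuscript; nothing here proves resolution of singularities in positive characteristic.

The tree PROVES CJS Cor. 6.18 with Thm. 6.17 in EVERY dimension (`resolutionSequenceInDim_of_sigmaMaxEliminationInDim d`:
`Σ^max`-eliminations in dimension `≤ d` ⟹ every reduced excellent Noetherian scheme of dimension `≤ d` is resolved by a blow-up
sequence with centres over its singular locus, `ResolutionSequenceInDim d`) and the Def. 6.14 gluing
(`sigmaMaxEliminationInDim_of_nuEliminationInDim d`).  For `d ≤ 2` the hypothesis is CJS Thm. 6.28 (printed); for `d ≥ 3` it is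
"the open input of the CJS programme (p. 17, Rem. 6.29)" (`SigmaMaxEliminationInDim.lean`).  This file shows that the line's
downstairs leaves in EVERY dimension — hence the crux — follow from that single `ℕ`-indexed predicate:

* `blowupModel_of_resolutionSequenceInDim` — an integral closed `H ⊆ ℙⁿ_k` (any field `k`) of dimension `≤ d` has, under
  `ResolutionSequenceInDim d`, a non-zero ideal sheaf ALL of whose blow-ups are regular: `H` is excellent (finite type over a
  field, `Stacks07QW_field_holds`), the blow-up sequence composes to ONE blow-up supported in `H ∖ Reg H`
  (`Theorems.CentreSeq.exists_isBlowup_comp_of_centresOver`, Temkin 2.1.4 / Stacks 080B), which misses the regular generic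
  point (so `𝔞 ≠ ⊥`), and blow-ups of `𝔞` are unique up to isomorphism;
* `blowupModel_ge_three_of_resolutionSequenceInDim` — the line's hypothesis `hBM` of `equisingularLift_of_blowupModels` (all
  `n ≥ 3`) from `∀ d ≥ 2, ResolutionSequenceInDim d` (`H ⊊ ℙⁿ_k` has dimension `≤ n − 1`,
  `TeissierReduction.isIso_or_topologicalKrullDim_le_of_isClosedImmersion_projectiveSpace`; `H = ℙⁿ_k` is regular);
* `stub_blowupModel_ge_five_of_resolutionSequenceInDim_ge_four` / `…_of_sigmaMaxEliminationInDim_ge_four` /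
  `…_of_nuEliminationInDim_ge_four` — **the OPEN residual `stub_blowupModel_ge_five` (registered signature verbatim after one
  binder) from `Σ^max`- (or `ν`-) eliminations in dimensions `≥ 4` alone**;
* `EquisingularLift_of_resolutionSequenceInDim` / `EquisingularLift_of_sigmaMaxEliminationInDim` /
  `EquisingularLift_of_nuEliminationInDim` — **the crux from `∀ d ≥ 2, SigmaMaxEliminationInDim d`** (resp. the `ν`-wise form).

Honest label: CONDITIONAL results on an open programme statement (for `d ≥ 3` nothing is in print); they REPLACE the line's
three heterogeneous named inputs by one uniform predicate and do not close the item.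

References: [CossartJannsenSaito2020, Def. 6.14/6.15, Thm. 6.17, Cor. 6.18, Rem. 6.29, Thm. 6.28]; [Temkin2008, Lemma 2.1.4];
[StacksProject, Tag 080B, Tag 07QW].
-/

set_option linter.dupNamespace false -- mandated namespace `Summit.<Summit>.<Problem>` of this single-conjunct summit

noncomputable section

open CategoryTheory AlgebraicGeometry TopologicalSpace
open Literature.AlgebraicGeometry.Resolution Literature.AlgebraicGeometry.Motives

universe u

namespace Summit.ResolutionOfSingularities.ResolutionOfSingularities.Cruxes.EquisingularLift.StrataSplit

/-! ## Regular blow-up models from a resolution by a blow-up sequence -/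

/-- **Regular blow-up models of integral projective `k`-schemes of dimension `≤ d` from `ResolutionSequenceInDim d`.**
For an integral closed `H ⊆ ℙⁿ_k` with `dim H ≤ d`: `H` is Noetherian and excellent (finite type over a field), so the
hypothesis gives a blow-up sequence `s` with centres over `H ∖ Reg H` and regular last scheme; it composes to ONE blow-up along
an ideal sheaf `𝔞` supported in `H ∖ Reg H` (Temkin 2008 Lemma 2.1.4 / Stacks 080B iterated), `𝔞 ≠ ⊥` since the generic point
is regular, and every blow-up of `𝔞` is isomorphic to the regular `s.top`.
[cite: CossartJannsenSaito2020, Cor. 6.18 (conclusion)] [cite: Temkin2008, Lemma 2.1.4] [cite: StacksProject, Tag 080B] -/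
theorem blowupModel_of_resolutionSequenceInDim {d : ℕ} (h : ResolutionSequenceInDim.{u} d) {k : Type u} [Field k] {n : ℕ}
    {H : Scheme.{u}} [IsIntegral H] (ι : H ⟶ (projectiveSpace n k).left) [IsClosedImmersion ι]
    (hdim : topologicalKrullDim H ≤ (d : WithBot ℕ∞)) :
    ∃ 𝔞 : H.IdealSheafData, 𝔞 ≠ ⊥ ∧
      ∀ (Z : Scheme.{u}) (π : Z ⟶ H), IsBlowup π 𝔞 → Scheme.IsRegular Z := by
  obtain ⟨hN, -⟩ := isNoetherian_and_isQuasiExcellent_of_isClosedImmersion_projectiveSpace n ι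
  haveI := hN
  haveI : IsProper (projectiveSpace n k).hom := isProper_projectiveSpace n k
  have hexc : Scheme.IsExcellent H :=
    Scheme.isExcellent_of_locallyOfFiniteType Stacks07QW_field_holds (ι ≫ (projectiveSpace n k).hom)
  obtain ⟨s, hs, hreg⟩ := h H hexc hdim
  obtain ⟨K, hK, hKsupp⟩ :=
    Summit.ResolutionOfSingularities.ResolutionOfSingularities.Theorems.CentreSeq.exists_isBlowup_comp_of_centresOver s _ hs
  refine ⟨K, fun h0 => ?_, fun Z π' hπ' => ?_⟩
  · -- `K = ⊥` would put the (regular) generic point in `Supp K ⊆ (Reg H)ᶜ`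
    have hmem : genericPoint H ∈ (K.support : Set H) := by
      rw [h0, Scheme.IdealSheafData.support_bot]; trivial
    exact hKsupp hmem (genericPoint_mem_regularLocus H)
  · obtain ⟨e, -, -⟩ := hK.unique hπ'
    exact hreg.of_iso e.hom

/-- **The line's hypothesis `hBM` (regular blow-up models of integral hypersurfaces of `ℙⁿ_k̄`, all `n ≥ 3`) from
`ResolutionSequenceInDim d` for all `d ≥ 2`**: either `ι` is an isomorphism (`H ≅ ℙⁿ_k` regular, `𝔞 = ⊤`) or `dim H ≤ n − 1`
(`isIso_or_topologicalKrullDim_le_of_isClosedImmersion_projectiveSpace`) and `blowupModel_of_resolutionSequenceInDim` applies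
with `d = n − 1 ≥ 2`. [cite: CossartJannsenSaito2020, Cor. 6.18] -/
theorem blowupModel_ge_three_of_resolutionSequenceInDim (h : ∀ d : ℕ, 2 ≤ d → ResolutionSequenceInDim.{0} d) :
    ∀ p : ℕ, p.Prime → ∀ (k : Type) [Field k] [CharP k p] [IsAlgClosed k] (n : ℕ) (H : AlgebraicGeometry.Scheme.{0}) (ι : H ⟶ (Literature.AlgebraicGeometry.Motives.projectiveSpace n k).left), AlgebraicGeometry.IsClosedImmersion ι → AlgebraicGeometry.IsIntegral H → (∀ y : (Literature.AlgebraicGeometry.Motives.projectiveSpace n k).left, ∃ U : (Literature.AlgebraicGeometry.Motives.projectiveSpace n k).left.affineOpens, y ∈ (U : (Literature.AlgebraicGeometry.Motives.projectiveSpace n k).left.Opens) ∧ (ι.ker.ideal U).IsPrincipal) → 3 ≤ n → ∃ 𝔞 : H.IdealSheafData, 𝔞 ≠ ⊥ ∧ ∀ (Z : AlgebraicGeometry.Scheme.{0}) (π : Z ⟶ H), Literature.AlgebraicGeometry.Resolution.IsBlowup π 𝔞 → Literature.AlgebraicGeometry.Resolution.Scheme.IsRegular Z := by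
  intro p hp k _ _ _ n H ι hι hH hloc hn
  obtain ⟨m, rfl⟩ : ∃ m : ℕ, n = m + 1 := ⟨n - 1, by omega⟩
  rcases Summit.ResolutionOfSingularities.ResolutionOfSingularities.Theorems.TeissierReduction.isIso_or_topologicalKrullDim_le_of_isClosedImmersion_projectiveSpace
      m ι with hiso | hdim
  · haveI := hiso
    exact exists_blowupModel_of_isRegular
      (Scheme.IsRegular.of_iso (inv ι) (isRegular_projectiveSpace (m + 1) k))
  · exact blowupModel_of_resolutionSequenceInDim (h m (by omega)) ι (by exact_mod_cast hdim)

/-! ## The open residual `stub_blowupModel_ge_five` from eliminations in dimension `≥ 4` -/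

/-- **The residual `stub_blowupModel_ge_five` (registered signature verbatim after the binder) from resolutions by blow-up
sequences in all dimensions `d ≥ 4`** (`ResolutionSequenceInDim d`, the conclusion of CJS Cor. 6.18 in dimension `d`).
[cite: CossartJannsenSaito2020, Cor. 6.18, Rem. 6.29] -/
theorem stub_blowupModel_ge_five_of_resolutionSequenceInDim_ge_four (h : ∀ d : ℕ, 4 ≤ d → ResolutionSequenceInDim.{0} d) : ∀ p : ℕ, p.Prime → ∀ (k : Type) [Field k] [CharP k p] [IsAlgClosed k] (n : ℕ) (H : AlgebraicGeometry.Scheme.{0}) (ι : H ⟶ (Literature.AlgebraicGeometry.Motives.projectiveSpace n k).left), AlgebraicGeometry.IsClosedImmersion ι → AlgebraicGeometry.IsIntegral H → (∀ y : (Literature.AlgebraicGeometry.Motives.projectiveSpace n k).left, ∃ U : (Literature.AlgebraicGeometry.Motives.projectiveSpace n k).left.affineOpens, y ∈ (U : (Literature.AlgebraicGeometry.Motives.projectiveSpace n k).left.Opens) ∧ (ι.ker.ideal U).IsPrincipal) → 5 ≤ n → ∃ 𝔞 : H.IdealSheafData, 𝔞 ≠ ⊥ ∧ ∀ (Z : AlgebraicGeometry.Scheme.{0})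 (π : Z ⟶ H), Literature.AlgebraicGeometry.Resolution.IsBlowup π 𝔞 → Literature.AlgebraicGeometry.Resolution.Scheme.IsRegular Z := by
  intro p hp k _ _ _ n H ι hι hH hloc hn
  obtain ⟨m, rfl⟩ : ∃ m : ℕ, n = m + 1 := ⟨n - 1, by omega⟩
  rcases Summit.ResolutionOfSingularities.ResolutionOfSingularities.Theorems.TeissierReduction.isIso_or_topologicalKrullDim_le_of_isClosedImmersion_projectiveSpace
      m ι with hiso | hdim
  · haveI := hiso
    exact exists_blowupModel_of_isRegular
      (Scheme.IsRegular.of_iso (inv ι) (isRegular_projectiveSpace (m + 1) k))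
  · exact blowupModel_of_resolutionSequenceInDim (h m (by omega)) ι (by exact_mod_cast hdim)

/-- **The residual `stub_blowupModel_ge_five` from `Σ^max`-eliminations in all dimensions `d ≥ 4`** (`SigmaMaxEliminationInDim d`,
the hypothesis of CJS Cor. 6.18 — open for `d ≥ 3`; Cor. 6.18/Thm. 6.17 proved in the tree in every dimension).
[cite: CossartJannsenSaito2020, Cor. 6.18, Thm. 6.17, Rem. 6.29] -/
theorem stub_blowupModel_ge_five_of_sigmaMaxEliminationInDim_ge_four (h : ∀ d : ℕ, 4 ≤ d → SigmaMaxEliminationInDim.{0} d) : ∀ p : ℕ, p.Prime → ∀ (k : Type) [Field k] [CharP k p] [IsAlgClosed k] (n : ℕ) (H : AlgebraicGeometry.Scheme.{0}) (ι : H ⟶ (Literature.AlgebraicGeometry.Motives.projectiveSpace n k).left), AlgebraicGeometry.IsClosedImmersion ι → AlgebraicGeometry.IsIntegral H → (∀ y : (Literature.AlgebraicGeometry.Motives.projectiveSpace n k).left, ∃ U : (Literature.AlgebraicGeometry.Motives.projectiveSpace n k).left.affineOpens, y ∈ (U : (Literature.AlgebraicGeometry.Motives.projectiveSpace n k).left.Opens)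 ∧ (ι.ker.ideal U).IsPrincipal) → 5 ≤ n → ∃ 𝔞 : H.IdealSheafData, 𝔞 ≠ ⊥ ∧ ∀ (Z : AlgebraicGeometry.Scheme.{0}) (π : Z ⟶ H), Literature.AlgebraicGeometry.Resolution.IsBlowup π 𝔞 → Literature.AlgebraicGeometry.Resolution.Scheme.IsRegular Z :=
  stub_blowupModel_ge_five_of_resolutionSequenceInDim_ge_four
    fun d hd => resolutionSequenceInDim_of_sigmaMaxEliminationInDim d (h d hd)

/-- **The residual `stub_blowupModel_ge_five` from `ν`-eliminations in all dimensions `d ≥ 4`** (`NuEliminationInDim d`, the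
`ν`-wise form; Def. 6.14 gluing proved in the tree). [cite: CossartJannsenSaito2020, Def. 6.14, Cor. 6.18] -/
theorem stub_blowupModel_ge_five_of_nuEliminationInDim_ge_four (h : ∀ d : ℕ, 4 ≤ d → NuEliminationInDim.{0} d) : ∀ p : ℕ, p.Prime → ∀ (k : Type) [Field k] [CharP k p] [IsAlgClosed k] (n : ℕ) (H : AlgebraicGeometry.Scheme.{0}) (ι : H ⟶ (Literature.AlgebraicGeometry.Motives.projectiveSpace n k).left), AlgebraicGeometry.IsClosedImmersion ι → AlgebraicGeometry.IsIntegral H → (∀ y : (Literature.AlgebraicGeometry.Motives.projectiveSpace n k).left, ∃ U : (Literature.AlgebraicGeometry.Motives.projectiveSpace n k).left.affineOpens, y ∈ (U : (Literature.AlgebraicGeometry.Motives.projectiveSpace n k).left.Opens) ∧ (ι.ker.ideal U).IsPrincipal) → 5 ≤ n → ∃ 𝔞 : H.IdealSheafData, 𝔞 ≠ ⊥ ∧ ∀ (Z : AlgebraicGeometry.Scheme.{0}) (π : Z ⟶ H), Literature.AlgebraicGeometry.Resolution.IsBlowup π 𝔞 → Literature.AlgebraicGeometry.Resolution.Scheme.IsRegular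 Z :=
  stub_blowupModel_ge_five_of_resolutionSequenceInDim_ge_four
    fun d hd => resolutionSequenceInDim_of_nuEliminationInDim d (h d hd)

/-! ## The crux from one uniform programme statement -/

/-- **`EquisingularLift` from resolutions by blow-up sequences in all dimensions `d ≥ 2`** (`ResolutionSequenceInDim d`): the
linear-centre lift `equisingularLift_of_blowupModels` over `blowupModel_ge_three_of_resolutionSequenceInDim`. CONDITIONAL.
[cite: CossartJannsenSaito2020, Cor. 6.18] -/
theorem EquisingularLift_of_resolutionSequenceInDim (h : ∀ d : ℕ, 2 ≤ d → ResolutionSequenceInDim.{0} d) :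
    Summit.ResolutionOfSingularities.ResolutionOfSingularities.Theses.EquisingularLift.EquisingularLift :=
  equisingularLift_of_blowupModels (blowupModel_ge_three_of_resolutionSequenceInDim h)

/-- **`EquisingularLift` from «`Σ^max`-eliminations exist in dimension `≤ d`» for all `d ≥ 2`** (`SigmaMaxEliminationInDim d`:
CJS Thm. 6.28 for `d = 2`, the open CJS programme input for `d ≥ 3`). CONDITIONAL; the crux's ENTIRE debt as one uniform
predicate. [cite: CossartJannsenSaito2020, Cor. 6.18, Thm. 6.17, Thm. 6.28, Rem. 6.29] -/
theorem EquisingularLift_of_sigmaMaxEliminationInDim (h : ∀ d : ℕ, 2 ≤ d → SigmaMaxEliminationInDim.{0} d) :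
    Summit.ResolutionOfSingularities.ResolutionOfSingularities.Theses.EquisingularLift.EquisingularLift :=
  EquisingularLift_of_resolutionSequenceInDim fun d hd => resolutionSequenceInDim_of_sigmaMaxEliminationInDim d (h d hd)

/-- **`EquisingularLift` from «`ν`-eliminations exist in dimension `≤ d`» for all `d ≥ 2`** (`NuEliminationInDim d`). CONDITIONAL.
[cite: CossartJannsenSaito2020, Def. 6.14, Cor. 6.18, Thm. 6.28] -/
theorem EquisingularLift_of_nuEliminationInDim (h : ∀ d : ℕ, 2 ≤ d → NuEliminationInDim.{0} d) :
    Summit.ResolutionOfSingularities.ResolutionOfSingularities.Theses.EquisingularLift.EquisingularLift :=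
  EquisingularLift_of_resolutionSequenceInDim fun d hd => resolutionSequenceInDim_of_nuEliminationInDim d (h d hd)

/-- **Mixed form: `EquisingularLift` from CJS Thm. 6.28 (`d = 2`, printed), Cossart–Piltant 2008/2009 (`d = 3`, printed) and
`Σ^max`-eliminations in dimensions `≥ 4` (open)** — the line's three leaves each on its sharpest available source.
[cite: CossartJannsenSaito2020, Thm. 6.28] [cite: CossartPiltant2008, Thm. 2.1] -/
theorem EquisingularLift_of_sigmaMaxElimination_CP2008_sigmaMaxEliminationInDim_ge_four
    (hσ : CossartJannsenSaito2020_sigmaMaxElimination.{0})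
    (h2008 : Literature.AlgebraicGeometry.CossartPiltant200819.CP2008.ResolutionQuasiProjectiveThreefolds.{0})
    (h4 : ∀ d : ℕ, 4 ≤ d → SigmaMaxEliminationInDim.{0} d) :
    Summit.ResolutionOfSingularities.ResolutionOfSingularities.Theses.EquisingularLift.EquisingularLift :=
  EquisingularLift_of_sigmaMaxElimination_CP2008_of_blowupModels_ge_five hσ h2008
    (stub_blowupModel_ge_five_of_sigmaMaxEliminationInDim_ge_four h4)

end Summit.ResolutionOfSingularities.ResolutionOfSingularities.Cruxes.EquisingularLift.StrataSplit

end
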